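import Summits.CriticalPhenomena.PercolationContinuityZ3.Theorems.Transplant.SkelNegBChoiceAllTA
import Summits.CriticalPhenomena.PercolationContinuityZ3.Theorems.Transplant.SkelNegBParamsLFA
import Summits.CriticalPhenomena.PercolationContinuityZ3.Theorems.Transplant.SkelNeg1ChoiceL
import HarnessLib

/-!
# N1 (the `{±1}` node), (C) column under (ζ′) — glue (C-A8-K glue): **`ReachHoldsRHNOFnL NegB.LfA` OF THE (ζ′) CHOICE FUNCTION `negChoiceAllOTA` FROM THE
# PER-POINT CORRIDOR RESIDUE** — `PlanarSkeletonNeg.reachHoldsRHNOFnL_negChoiceAllOTA_of`: if at every `(κ, G, Φ, t, p, hC, O, q)` with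
# `(NegB.choiceAtOTA …).AtQO O q` (one vertex type, `0 < p < 1`) the residue `Skel.ReachOblRHN G (926·Kq) ((choiceAtOTA …).scheme O q)
# ((choiceAtOTA …).FD O q) Φ.Δ (κ.δr 0)` holds (corridor length `926·Kq ≤ NegB.LfA κ.K₀ = 2000·Kq`, kits at the FLAT ROOT ACCURACY `κ.δr 0`), then
# `ReachHoldsRHNOFnL NegB.LfA (negChoiceAllOTA gv fv Pv Sv)` — the (C) hypothesis of the closure of record `samePDropOfSkeletonNeg₁_of_choiceFnNOWL`
# (ADOPTION IN FORCE (L), lead 2026-08-22T04:19Z). Plus **`NegB.choiceAtOTA_reach_iff`**: the scheme and face data of the (ζ′) chain are LITERALLY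
# `⟨cellGeomSG₂b G (fineOA …) (fcellsA …) t (concRadii2N (fcellsA …) gap (fun _ => 0) E₀ L′ (offNA …)) (b0TA …), q, κ.δ⟩` / `faceDataSG …` with
# `gap/E₀/L′ := Skelφ.Prm.gap/E₀/Lp (Sv … q)` — the shape `Skelφ.reachOblRHN_negSG₂b_of_floorsK` (C-S11-K) concludes, so the instantiation is ONE `exact`.

builds on p205010 (kernel theorem, internal audit signed; external expert review pending) — nothing in this file uses p205010; NOTHING is claimed about the
open node `SamePDropOfSkeletonNeg₁`.
Lane `prim-bschramm`, seat `prim-bschramm-p5` (gen 11; (C) lineage); helper file (`--supports stmt-CriticalPhenomena-4575 --as helper`); slot-ledger ζ′ v1.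
[cite: KozmaNitzan2024, §4 Theorem 6 (pp. 25–31), Lemma 12 (pp. 23–25)] [folklore]
-/

noncomputable section

open scoped Classical

namespace Summit.CriticalPhenomena.PercolationContinuityZ3.Theorems.Transplant

namespace PlanarSkeletonNeg

open SkelConc (Consts)
open Skelφ.StepI (OutO)
open Literature.Probability.Percolation

/-- **`ReachHoldsRHNOFnL NegB.LfA (negChoiceAllOTA …)` from the per-point corridor residue of length `926·Kq` at `AtQO`** (`926·Kq ≤ LfA κ.K₀ = 2000·Kq`).
[folklore] -/
theorem reachHoldsRHNOFnL_negChoiceAllOTA_of (gv fv : Neg.FSlot) (Pv : NegB.PSlot) (Sv : NegB.SSlot)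
    (h : ∀ (κ : Consts) {V : Type} [DecidableEq V] [Countable V] (G : SimpleGraph V) [G.LocallyFinite] (Φ : PlanarSkeletonNeg G) (t : V) (p : unitInterval)
      (hC : Φ.CylSubcritical p) (O : OutO V) (q : unitInterval), (NegB.choiceAtOTA κ Φ t p gv fv Sv hC Pv).AtQO O q → Φ.types = {t} → 0 < (p : ℝ) → (p : ℝ) < 1 →
      Skel.ReachOblRHN G (926 * Neg.Kq κ) ((NegB.choiceAtOTA κ Φ t p gv fv Sv hC Pv).scheme O q) ((NegB.choiceAtOTA κ Φ t p gv fv Sv hC Pv).FD O q) Φ.Δ (κ.δr 0)) :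
    ReachHoldsRHNOFnL NegB.LfA (negChoiceAllOTA gv fv Pv Sv) := by
  intro κ V _ _ G _ Φ hg t ht h1 p hp0 hp1 hC O q hAt
  rw [negChoiceAllOTA_eq] at hAt ⊢
  exact ⟨926 * Neg.Kq κ, by rw [NegB.LfA_eq]; omega, h κ G Φ t p hC O q hAt h1 hp0 hp1⟩

/-- **The scheme and face data of the (ζ′) chain, by name**: the shape `Skelφ.reachOblRHN_negSG₂b_of_floorsK` concludes (any step budget `nmax`, any
accuracy `δ`). [folklore] -/
theorem NegB.choiceAtOTA_reach_iff (κ : Consts) {V : Type} [DecidableEq V] [Countable V] {G : SimpleGraph V} [G.LocallyFinite] (Φ : PlanarSkeletonNeg G) (t : V)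
    (p : unitInterval) (gv fv : Neg.FSlot) (Sv : NegB.SSlot) (hC : Φ.CylSubcritical p) (Pv : NegB.PSlot) (O : OutO V) (q : unitInterval) {nmax Δ : ℕ} {δ : ℝ} :
    Skel.ReachOblRHN G nmax ((NegB.choiceAtOTA κ Φ t p gv fv Sv hC Pv).scheme O q) ((NegB.choiceAtOTA κ Φ t p gv fv Sv hC Pv).FD O q) Δ δ ↔
      Skel.ReachOblRHN G nmax
        (⟨Skelφ.cellGeomSG₂b G (NegB.fineOA κ Φ t p O.D O.DT O.ori (NegB.gOf κ Φ t p O gv) (NegB.fOf κ Φ t p O fv))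
            (NegB.fcellsA κ Φ t p O.merged (NegB.gOf κ Φ t p O gv) (NegB.fOf κ Φ t p O fv)) t
            (Skelφ.concRadii2N (NegB.fcellsA κ Φ t p O.merged (NegB.gOf κ Φ t p O gv) (NegB.fOf κ Φ t p O fv))
              (Skelφ.Prm.gap (Sv κ Φ t p O.merged (NegB.gOf κ Φ t p O gv) (NegB.fOf κ Φ t p O fv) q)) (fun _ => 0)
              (Skelφ.Prm.E₀ (Sv κ Φ t p O.merged (NegB.gOf κ Φ t p O gv) (NegB.fOf κ Φ t p O fv) q))
              (Skelφ.Prm.Lp (Sv κ Φ t p O.merged (NegB.gOf κ Φ t p O gv) (NegB.fOf κ Φ t p O fv) q))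
              (NegB.offNA κ Φ t p O.merged (NegB.gOf κ Φ t p O gv) (NegB.fOf κ Φ t p O fv)))
            (NegB.b0TA κ Φ t p O.merged (NegB.gOf κ Φ t p O gv) (NegB.fOf κ Φ t p O fv)), q, κ.δ⟩ : KNCells.KSchA V ℕ)
        (Skelφ.faceDataSG G (NegB.fineOA κ Φ t p O.D O.DT O.ori (NegB.gOf κ Φ t p O gv) (NegB.fOf κ Φ t p O fv))
          (NegB.fcellsA κ Φ t p O.merged (NegB.gOf κ Φ t p O gv) (NegB.fOf κ Φ t p O fv)) t
          (Skelφ.concRadii2N (NegB.fcellsA κ Φ t p O.merged (NegB.gOf κ Φ t p O gv) (NegB.fOf κ Φ t p O fv))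
            (Skelφ.Prm.gap (Sv κ Φ t p O.merged (NegB.gOf κ Φ t p O gv) (NegB.fOf κ Φ t p O fv) q)) (fun _ => 0)
            (Skelφ.Prm.E₀ (Sv κ Φ t p O.merged (NegB.gOf κ Φ t p O gv) (NegB.fOf κ Φ t p O fv) q))
            (Skelφ.Prm.Lp (Sv κ Φ t p O.merged (NegB.gOf κ Φ t p O gv) (NegB.fOf κ Φ t p O fv) q))
            (NegB.offNA κ Φ t p O.merged (NegB.gOf κ Φ t p O gv) (NegB.fOf κ Φ t p O fv))))
        Δ δ :=
  Iff.rfl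

end PlanarSkeletonNeg

end Summit.CriticalPhenomena.PercolationContinuityZ3.Theorems.Transplant

end
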